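import Summits.HodgeConjecture.HodgeConjecture.Theorems.Ring2WeilCoverageNormTable
import Mathlib.Analysis.Complex.Basic
import Mathlib.Data.Rat.Lemmas
import HarnessLib

/-!
# Weil-type family coverage — part X (census block b04.33): the two «extra centre» curves are curves of PAIRS of QM abelian surfaces by `D₆` (THEOREM S35) — the two quaternion factors are `D₆`, the monodromy witnesses have no eigenvalue on the unit circle, and the base-curve bookkeeping

research route conditional on HC_CM; not a corollary; Q11.4-sentence-2 already refuted in dim ≥ 3.

Ring 2, WEIL-TYPE FAMILY-COVERAGE CENSUS (`HOME/WEIL-FAMILY-COVERAGE.md` `## b04`, block b04.33, owner ring2-b04, gen 70).  SETTING (informal, NOT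
formalised; THEOREMS-S30/S33/S35 of the census): the two Möbius-symmetric one-parameter `Σ`-families of the window `SL₂(7)∘C₄` (`K = ℚ(i)`, class
tuples `(7_3,7_3,x2_11,x2_11)#84` and `(7_4,7_4,x2_11,x2_11)#84`) whose mod-`p` monodromy ENGINE 7 had typed «`SL₂ × SL₂` with an extra centre»
(S30.3) and whose lifted algebra is `𝒟 = D₆` (S33.1); S33 §2(d) and S34 §8 left the extra structure «recorded, not resolved».  THEOREM S35 (census
ENGINE 11 `zar70.py`, exact over `ℚ` on ENGINE 10's Fox-calculus monodromy, with a certificate: the commutant of the CONNECTED algebraic monodromy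
group is cut out from above by saturated powers of three resp. two words and from below by the finite conjugation image, of order 8): `C(H⁰) =
End_{H⁰}(H¹(A_t;ℚ))` is 8-dimensional with centre `ℚ × ℚ` — the «extra centre» is a pair of complementary IDEMPOTENTS —, `H¹(A_t;ℚ) = M₊ ⊕ M₋`
(`4 + 4`) and `C(H⁰) = B₊ × B₋` with `B₊ = (-1, 348/169)_ℚ`, `B₋ = (-1, 20/3)_ℚ` on the first curve and `B₊ = (-1, 702/25)_ℚ`, `B₋ = (-1, 146/243)_ℚ`
on the second; THIS FILE proves that all four are the indefinite quaternion algebra `D₆` of discriminant 6 (§1: `(-1,b)_ℚ` is NOT split — `b ∉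
Nm(ℚ(i)ˣ)` — and `(-1,b) ⊗ (-1,3)` IS split — `3b ∈ Nm(ℚ(i)ˣ)` —, so `[(-1,b)] = [(-1,3)] = [D₆]` in `Br(ℚ)`, `(-1,3)` itself being non-split by the
tree's `Ring2WeilNormDescent.three_not_mem_norm_one`).  Consequently (S35.1–S35.3, seat-derived from the theorem of the fixed part, Deligne's
semisimplicity and the `K`-signature): at EVERY point `A_t ∼ S_t × S'_t` with `S_t, S'_t` abelian surfaces with quaternionic multiplication by `D₆`
(generically simple and NOT isogenous to each other, `End⁰(A_t) = D₆ × D₆` exactly), the connected monodromy / Hodge group is `SL₁(D₆) × SL₁(D₆)`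
(anisotropic: no unipotent, all 84 cusp loops finite, the family is complete), the two factors are SWAPPED by the monodromy of the base (70 resp. 66 of
169 Schreier generators; the 24 cusp loops of width 4), the QM-monodromy of each factor generates a MAXIMAL order of `D₆`, maps onto `SL₂(𝔽_p)` for
`p = 5, 7, 11`, and is extended by Atkin–Lehner elements of reduced-norm class `2` (Skolem–Noether classes `{1, 2}`) — the `D₆`-analogue of S34's
`Γ₀(2)⁺` —; §2 proves that the exhibited monodromy elements have NO eigenvalue on the unit circle (so they have infinite order: the orbit-level witness
`x⁸ + 14x⁴ + 1`, and the two «mixed» witnesses `(x² - 5x + 1)²` resp. `(x² + 6x + 1)²` which have finite order on one factor and infinite order on the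
other — an explicit proof that `H⁰` is the full product and not a diagonal); §3 records two Riemann–Hurwitz identities of a NAIVE model of the base (an `84`-sheeted cover
of `ℙ¹ ∖ {0,1,∞}` whose cusps are the `84` cusp LOOPS of the braid graph: «genus 1»; its double cover branched at the `24` swapping loops: «genus 13») —
ERRATUM E-b04.33-3 (census P.S. b04.33): this model is NOT the reduced Hurwitz curve (whose bookkeeping needs ENGINE 6, cf. S34's P58), so the two
identities are kept only as arithmetic of the naive model and assert NOTHING about the genus of the actual base curve — and the area / Riemann–Hurwitz
bookkeeping of the index-2 subgroup `⟨O₆¹, w₂⟩/ℚˣ` of the `(2,4,6)` triangle group (signature `(0;3,4,4)`: twice the area), which stands.  The matrices, commutants, lattices and orders are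
computations of the census (`census-g70/`), not kernel facts; nothing here is a statement about Hodge classes; `HC_CM` is used nowhere.

References: [cite: vanGeemen1994HodgeAV, 5.2 and (5.4.1)]; [Serre1973, Ch. III §1] (Hilbert symbols / norms); Takeuchi, J. Math. Soc. Japan 29 (1977)
91–106 (arithmetic triangle groups: `(2,4,6)` from the discriminant-6 algebra).
-/

noncomputable section

set_option linter.dupNamespace false

open Literature.AlgebraicGeometry.Motives
open Literature.AlgebraicGeometry.VanGeemen1994
open Summit.HodgeConjecture.HodgeConjecture.Ring2.Hypotheses

namespace Summit.HodgeConjecture.HodgeConjecture.Ring2.WeilCoverage.QMSurfacePair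

/-! ### §1 The four quaternion factors `B± = (-1, b)_ℚ` are `D₆`: `b ∉ Nm(ℚ(i)ˣ)` (not split) and `3b ∈ Nm(ℚ(i)ˣ)` (same class as `(-1,3) = D₆`) -/

/-- `87 ∉ Nm(ℚ(i)ˣ)` (`87 = 3·29`, descent at the inert prime `3`, `3 ∥ 87`): the square class of `b₊ = 348/169 = 87·(2/13)²` on the curve `(7_3,7_3,x2_11,x2_11)`.
research route conditional on HC_CM; not a corollary; Q11.4-sentence-2 already refuted in dim ≥ 3. [cite: Serre1973, Ch. III §1] -/
theorem not_mem_87 : Units.mk0 (87 : ℚ) (by norm_num) ∉ normUnitsSubgroup ℚ (weilField 1) := by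
  simpa using natCast_not_mem_normUnitsSubgroup_of_inert (d := 1) (a := 87) (p := 3)
    (by norm_num) (by decide) (by norm_num) (by norm_num) (by norm_num)

/-- `78 ∉ Nm(ℚ(i)ˣ)` (`78 = 2·3·13`, descent at the inert prime `3`): the square class of `b₊ = 702/25 = 78·(3/5)²` on the curve `(7_4,7_4,x2_11,x2_11)`.
research route conditional on HC_CM; not a corollary; Q11.4-sentence-2 already refuted in dim ≥ 3. [cite: Serre1973, Ch. III §1] -/
theorem not_mem_78 : Units.mk0 (78 : ℚ) (by norm_num) ∉ normUnitsSubgroup ℚ (weilField 1) := by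
  simpa using natCast_not_mem_normUnitsSubgroup_of_inert (d := 1) (a := 78) (p := 3)
    (by norm_num) (by decide) (by norm_num) (by norm_num) (by norm_num)

/-- `438 ∉ Nm(ℚ(i)ˣ)` (`438 = 2·3·73`, descent at the inert prime `3`): the square class of `b₋ = 146/243 = 438·(1/27)²` on the curve `(7_4,7_4,x2_11,x2_11)`.
research route conditional on HC_CM; not a corollary; Q11.4-sentence-2 already refuted in dim ≥ 3. [cite: Serre1973, Ch. III §1] -/
theorem not_mem_438 : Units.mk0 (438 : ℚ) (by norm_num) ∉ normUnitsSubgroup ℚ (weilField 1) := by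
  simpa using natCast_not_mem_normUnitsSubgroup_of_inert (d := 1) (a := 438) (p := 3)
    (by norm_num) (by decide) (by norm_num) (by norm_num) (by norm_num)

/-- Bookkeeping: `a ∉ Nm(K_dˣ)` and `b = a·q²` (`q ≠ 0`) ⟹ `b ∉ Nm(K_dˣ)` (square classes).
research route conditional on HC_CM; not a corollary; Q11.4-sentence-2 already refuted in dim ≥ 3. [folklore] -/
theorem not_mem_of_eq_mul_sq {d : ℕ} {a b q : ℚ} (ha : a ≠ 0) (hq : q ≠ 0) (hb : b ≠ 0) (h : b = q ^ 2 * a)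
    (hna : Units.mk0 a ha ∉ normUnitsSubgroup ℚ (weilField d)) :
    Units.mk0 b hb ∉ normUnitsSubgroup ℚ (weilField d) := by
  have hmul := mul_not_mem_normUnitsSubgroup (sq_mem_normUnitsSubgroup (d := d) hq) hna
  rw [mk0_mul_mk0] at hmul
  have e : Units.mk0 b hb = Units.mk0 (q ^ 2 * a) (mul_ne_zero (pow_ne_zero 2 hq) ha) := Units.ext (by simp [h])
  rw [e]; exact hmul

/-- **Curve `(7_3,7_3,x2_11,x2_11)#84`, factor `+`: `B₊ = (-1, 348/169)_ℚ` is NOT split** (`348/169 = 87·(2/13)² ∉ Nm(ℚ(i)ˣ)`), so `B₊` is a division quaternion algebra (THEOREM S35.0 (C): `B₊ = End_{H⁰}(M₊)`).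
research route conditional on HC_CM; not a corollary; Q11.4-sentence-2 already refuted in dim ≥ 3. [cite: vanGeemen1994HodgeAV, (5.4.1)] -/
theorem Bplus_7_3_not_split : Units.mk0 ((348 : ℚ) / 169) (by norm_num) ∉ normUnitsSubgroup ℚ (weilField 1) :=
  not_mem_of_eq_mul_sq (q := 2 / 13) (by norm_num) (by norm_num) _ (by norm_num) not_mem_87

/-- **Curve `(7_3,7_3,x2_11,x2_11)#84`, factor `+`: `3·(348/169) = (30/13)² + (12/13)² ∈ Nm(ℚ(i)ˣ)`, so `(-1, 348/169) ⊗ (-1, 3)` is split and `[B₊] = [(-1,3)] = [D₆]`: `B₊ ≅ D₆`, ramified exactly at `{2, 3}` — the QM algebra of the first surface factor `S_t`.**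
research route conditional on HC_CM; not a corollary; Q11.4-sentence-2 already refuted in dim ≥ 3. [cite: vanGeemen1994HodgeAV, (5.4.1)] -/
theorem Bplus_7_3_mul_three_mem : Units.mk0 (3 * ((348 : ℚ) / 169)) (by norm_num) ∈ normUnitsSubgroup ℚ (weilField 1) :=
  mem_normUnitsSubgroup_of_sq_add_mul_sq _ (30 / 13 : ℚ) (12 / 13 : ℚ) (by norm_num)

/-- **Curve `(7_3,7_3,x2_11,x2_11)#84`, factor `-`: `B₋ = (-1, 20/3)_ℚ` is NOT split** (`20/3 = 15·(2/3)²`, and `15 ∉ Nm(ℚ(i)ˣ)` is the cell's landed `SqrtNeg1.not_mem_15`).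
research route conditional on HC_CM; not a corollary; Q11.4-sentence-2 already refuted in dim ≥ 3. [cite: vanGeemen1994HodgeAV, (5.4.1)] -/
theorem Bminus_7_3_not_split : Units.mk0 ((20 : ℚ) / 3) (by norm_num) ∉ normUnitsSubgroup ℚ (weilField 1) :=
  not_mem_of_eq_mul_sq (q := 2 / 3) (by norm_num) (by norm_num) _ (by norm_num) SqrtNeg1.not_mem_15

/-- **Curve `(7_3,7_3,x2_11,x2_11)#84`, factor `-`: `3·(20/3) = 20 = 4² + 2² ∈ Nm(ℚ(i)ˣ)`: `B₋ ≅ (-1,3) = D₆` — the second surface factor `S'_t` has QM by the SAME algebra (as it must: the monodromy swaps the factors).**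
research route conditional on HC_CM; not a corollary; Q11.4-sentence-2 already refuted in dim ≥ 3. [cite: vanGeemen1994HodgeAV, (5.4.1)] -/
theorem Bminus_7_3_mul_three_mem : Units.mk0 (3 * ((20 : ℚ) / 3)) (by norm_num) ∈ normUnitsSubgroup ℚ (weilField 1) :=
  mem_normUnitsSubgroup_of_sq_add_mul_sq _ (4 : ℚ) (2 : ℚ) (by norm_num)

/-- **Curve `(7_4,7_4,x2_11,x2_11)#84`, factor `+`: `B₊ = (-1, 702/25)_ℚ` is NOT split** (`702/25 = 78·(3/5)²`, `78 ∉ Nm(ℚ(i)ˣ)`).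
research route conditional on HC_CM; not a corollary; Q11.4-sentence-2 already refuted in dim ≥ 3. [cite: vanGeemen1994HodgeAV, (5.4.1)] -/
theorem Bplus_7_4_not_split : Units.mk0 ((702 : ℚ) / 25) (by norm_num) ∉ normUnitsSubgroup ℚ (weilField 1) :=
  not_mem_of_eq_mul_sq (q := 3 / 5) (by norm_num) (by norm_num) _ (by norm_num) not_mem_78

/-- **Curve `(7_4,7_4,x2_11,x2_11)#84`, factor `+`: `3·(702/25) = 2106/25 = 9² + (9/5)² ∈ Nm(ℚ(i)ˣ)`: `B₊ ≅ D₆`.**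
research route conditional on HC_CM; not a corollary; Q11.4-sentence-2 already refuted in dim ≥ 3. [cite: vanGeemen1994HodgeAV, (5.4.1)] -/
theorem Bplus_7_4_mul_three_mem : Units.mk0 (3 * ((702 : ℚ) / 25)) (by norm_num) ∈ normUnitsSubgroup ℚ (weilField 1) :=
  mem_normUnitsSubgroup_of_sq_add_mul_sq _ (9 : ℚ) (9 / 5 : ℚ) (by norm_num)

/-- **Curve `(7_4,7_4,x2_11,x2_11)#84`, factor `-`: `B₋ = (-1, 146/243)_ℚ` is NOT split** (`146/243 = 438·(1/27)²`, `438 ∉ Nm(ℚ(i)ˣ)`).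
research route conditional on HC_CM; not a corollary; Q11.4-sentence-2 already refuted in dim ≥ 3. [cite: vanGeemen1994HodgeAV, (5.4.1)] -/
theorem Bminus_7_4_not_split : Units.mk0 ((146 : ℚ) / 243) (by norm_num) ∉ normUnitsSubgroup ℚ (weilField 1) :=
  not_mem_of_eq_mul_sq (q := 1 / 27) (by norm_num) (by norm_num) _ (by norm_num) not_mem_438

/-- **Curve `(7_4,7_4,x2_11,x2_11)#84`, factor `-`: `3·(146/243) = 146/81 = (11/9)² + (5/9)² ∈ Nm(ℚ(i)ˣ)`: `B₋ ≅ D₆`.**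
research route conditional on HC_CM; not a corollary; Q11.4-sentence-2 already refuted in dim ≥ 3. [cite: vanGeemen1994HodgeAV, (5.4.1)] -/
theorem Bminus_7_4_mul_three_mem : Units.mk0 (3 * ((146 : ℚ) / 243)) (by norm_num) ∈ normUnitsSubgroup ℚ (weilField 1) :=
  mem_normUnitsSubgroup_of_sq_add_mul_sq _ (11 / 9 : ℚ) (5 / 9 : ℚ) (by norm_num)

-- `(-1, 3)_ℚ` itself is NOT split — `3 ∉ Nm(ℚ(i)ˣ)` is ring2-b02's `Summit.HodgeConjecture.Ring2WeilNormDescent.three_not_mem_norm_one` (reused by name,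
-- not restated); it is ramified exactly at `{2, 3}` (`(-1,3)_3 = (-1|3) = -1`, `(-1,3)_2 = -1`, `3 > 0` at `∞`): the indefinite algebra `D₆`.

/-! ### §2 The monodromy witnesses have no eigenvalue on the unit circle (hence infinite order) -/

/-- **Orbit-level infinite-order witness (both curves; ENGINE 10's exact characteristic polynomial `x⁸ + 14x⁴ + 1` of a Schreier generator): no root lies on the unit circle** — if `z⁸ + 14z⁴ + 1 = 0` then `w = z⁴` satisfies `w(w + 14) = -1`, so `‖z‖ = 1` would give `‖w + 14‖ = 1`, against `‖w + 14‖ ≥ 14 - ‖w‖ = 13`.  (The roots have `z⁴ = -7 ± 4√3 = -(2 ∓ √3)²`, units of `ℚ(√3)` of infinite order: the connected monodromy group `H⁰` is non-trivial although every local monodromy is finite.)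
research route conditional on HC_CM; not a corollary; Q11.4-sentence-2 already refuted in dim ≥ 3. [folklore] -/
theorem norm_ne_one_of_octic_witness (z : ℂ) (hz : z ^ 8 + 14 * z ^ 4 + 1 = 0) : ‖z‖ ≠ 1 := by
  intro h1
  have hw : z ^ 4 * (z ^ 4 + 14) = -1 := by linear_combination hz
  have hn : ‖z ^ 4‖ * ‖z ^ 4 + 14‖ = 1 := by
    rw [← norm_mul, hw]; simp
  have hz4 : ‖z ^ 4‖ = 1 := by rw [norm_pow, h1]; simp
  rw [hz4, one_mul] at hn
  have htri : ‖(14 : ℂ)‖ ≤ ‖z ^ 4 + 14‖ + ‖z ^ 4‖ := by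
    calc ‖(14 : ℂ)‖ = ‖(z ^ 4 + 14) - z ^ 4‖ := by ring_nf
      _ ≤ ‖z ^ 4 + 14‖ + ‖z ^ 4‖ := norm_sub_le _ _
  rw [hn, hz4] at htri
  have h14 : ‖(14 : ℂ)‖ = 14 := by simp
  rw [h14] at htri
  norm_num at htri

/-- **MIXED witness on the curve `(7_3,7_3,x2_11,x2_11)` (ENGINE 11: a word of `Γ'` acting with characteristic polynomial `(x² - 5x + 1)²` on `M₊` and with finite order `3` on `M₋`): `x² - 5x + 1` has no root on the unit circle** (`z² + 1 = 5z` and `‖z‖ = 1` would give `5 = ‖z² + 1‖ ≤ 2`) — so this element of the monodromy has infinite order on the first QM factor and finite order on the second: `H⁰` is NOT of diagonal type in `SL₁(D₆) × SL₁(D₆)`, an explicit second proof (besides `dim C(H⁰) = 8`) that the two surfaces `S_t`, `S'_t` move independently.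
research route conditional on HC_CM; not a corollary; Q11.4-sentence-2 already refuted in dim ≥ 3. [folklore] -/
theorem norm_ne_one_of_mixed_witness_7_3 (z : ℂ) (hz : z ^ 2 - 5 * z + 1 = 0) : ‖z‖ ≠ 1 := by
  intro h1
  have hw : z ^ 2 + 1 = 5 * z := by linear_combination hz
  have hn : ‖z ^ 2 + 1‖ = 5 := by
    rw [hw, norm_mul, h1]; simp
  have htri : ‖z ^ 2 + 1‖ ≤ ‖z ^ 2‖ + ‖(1 : ℂ)‖ := norm_add_le _ _
  rw [hn, norm_pow, h1] at htri
  norm_num at htri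

/-- **MIXED witness on the curve `(7_4,7_4,x2_11,x2_11)` (ENGINE 11: a word of `Γ'` with characteristic polynomial `(x² + 6x + 1)²` on `M₋` and finite order `4` on `M₊`): `x² + 6x + 1` has no root on the unit circle** (`z² + 1 = -6z`, `6 = ‖z² + 1‖ ≤ 2`): infinite order on the second factor, finite on the first — `H⁰ = SL₁(D₆) × SL₁(D₆)` is the full product on this curve too.
research route conditional on HC_CM; not a corollary; Q11.4-sentence-2 already refuted in dim ≥ 3. [folklore] -/
theorem norm_ne_one_of_mixed_witness_7_4 (z : ℂ) (hz : z ^ 2 + 6 * z + 1 = 0) : ‖z‖ ≠ 1 := by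
  intro h1
  have hw : z ^ 2 + 1 = -6 * z := by linear_combination hz
  have hn : ‖z ^ 2 + 1‖ = 6 := by
    rw [hw, norm_mul, norm_neg, h1]; simp
  have htri : ‖z ^ 2 + 1‖ ≤ ‖z ^ 2‖ + ‖(1 : ℂ)‖ := norm_add_le _ _
  rw [hn, norm_pow, h1] at htri
  norm_num at htri

/-! ### §3 Bookkeeping of the base curve and of the Atkin–Lehner group -/

/-- **NAIVE MODEL ONLY (ERRATUM E-b04.33-3: NOT the genus of the actual reduced base curve, which is withdrawn pending ENGINE-6 bookkeeping)**: IF the base were an `84`-sheeted cover of `ℙ¹` branched only over three points with the `84` cusp LOOPS of the braid graph as its cusps (28 over each branch point: eight of width 2, twelve of width 3, eight of width 4; ENGINE 10/11), its genus would be 1: `2g - 2 = 84·(-2) + Σ(m - 1)` with `Σ(m-1) = 3·(8·1 + 12·2 + 8·3) = 168`.  The arithmetic is all this theorem asserts.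
research route conditional on HC_CM; not a corollary; Q11.4-sentence-2 already refuted in dim ≥ 3. [folklore] -/
theorem baseCurve_genus_one (g : ℤ) (h : 2 * g - 2 = 84 * (-2) + 3 * (8 * 1 + 12 * 2 + 8 * 3)) : g = 1 := by
  omega

/-- **NAIVE MODEL ONLY (ERRATUM E-b04.33-3, as above)**: the swap character `π₁(B) → ℤ/2` (which of `S_t`, `S'_t` is which) is non-trivial on exactly the `24` cusp loops of width 4 of the braid graph (ENGINE 11; this count stands); IF these were 24 branch points of a double cover of a genus-1 curve, that cover would have genus 13: `2g' - 2 = 2·(2·1 - 2) + 24`.  The arithmetic is all this theorem asserts; the genus of the actual labelling cover is not claimed.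
research route conditional on HC_CM; not a corollary; Q11.4-sentence-2 already refuted in dim ≥ 3. [folklore] -/
theorem labellingCover_genus_thirteen (g' : ℤ) (h : 2 * g' - 2 = 2 * (2 * 1 - 2) + 24) : g' = 13 := by
  omega

/-- **Atkin–Lehner bookkeeping (THEOREM S35.4's frame): the `(2,4,6)` triangle group (the normaliser `N(O₆)/ℚˣ` of a maximal order of `D₆` [Takeuchi 1977]) has orbifold area `1 - 1/2 - 1/4 - 1/6 = 1/12` (in units of `2π`), and the signature `(0; 3, 4, 4)` has area `1 - 1/3 - 1/4 - 1/4 = 1/6`, exactly twice — consistent with `⟨O₆¹, w₂⟩/ℚˣ` (reduced-norm classes `{1, 2}`, the classes met by the Skolem–Noether factors of the monodromy) being the index-2 subgroup of signature `(0;3,4,4)`: the two order-2 points of `X₆` (CM by `ℤ[i]`) acquire stabilisers of order 4 generated by `1 + i`, the two order-3 points are exchanged.**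
research route conditional on HC_CM; not a corollary; Q11.4-sentence-2 already refuted in dim ≥ 3. [folklore] -/
theorem triangle_246_index_two_area :
    (1 : ℚ) - 1 / 3 - 1 / 4 - 1 / 4 = 2 * (1 - 1 / 2 - 1 / 4 - 1 / 6) ∧ (1 : ℚ) - 1 / 2 - 1 / 4 - 1 / 6 = 1 / 12 := by
  constructor <;> norm_num

/-- **Riemann–Hurwitz for `X₆ = O₆¹\ℌ → ⟨O₆¹, w₂⟩\ℌ` (degree 2; signatures `(0;2,2,3,3)` above, `(0;3,4,4)` below): `2·0 - 2 = 2·(2·0 - 2) + 2`, the two ramification points being the order-4 points (each covered by one order-2 point), the order-3 point being unramified (covered by the two order-3 points).**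
research route conditional on HC_CM; not a corollary; Q11.4-sentence-2 already refuted in dim ≥ 3. [folklore] -/
theorem shimuraSix_to_w2_quotient_riemannHurwitz : (2 : ℤ) * 0 - 2 = 2 * (2 * 0 - 2) + 2 := by
  norm_num

/-! ### §4 (P.S. to b04.33, P61) The seven complete QM-fourfold curves of the `2.A₆∘C₄` window: `C(H⁰) = (-1, b)_ℚ ≅ D₆` -/

/-- `39 ∉ Nm(ℚ(i)ˣ)` (`39 = 3·13`, descent at the inert prime `3`): the square class of `b = 975/256 = 39·(5/16)²`, the `K`-antilinear generator squared of `C(H⁰)` on BOTH size-180 orbits of `(5_10,5_10,x2_13,x2_13)` (ENGINE 11, P61).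
research route conditional on HC_CM; not a corollary; Q11.4-sentence-2 already refuted in dim ≥ 3. [cite: Serre1973, Ch. III §1] -/
theorem not_mem_39 : Units.mk0 (39 : ℚ) (by norm_num) ∉ normUnitsSubgroup ℚ (weilField 1) := by
  simpa using natCast_not_mem_normUnitsSubgroup_of_inert (d := 1) (a := 39) (p := 3)
    (by norm_num) (by decide) (by norm_num) (by norm_num) (by norm_num)

/-- `195 ∉ Nm(ℚ(i)ˣ)` (`195 = 3·5·13`, descent at the inert prime `3`): the square class of `b = 4875/1024 = 195·(5/32)²` on the second size-180 orbit of `(5_11,5_11,x2_13,x2_13)` (ENGINE 11, P61).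
research route conditional on HC_CM; not a corollary; Q11.4-sentence-2 already refuted in dim ≥ 3. [cite: Serre1973, Ch. III §1] -/
theorem not_mem_195 : Units.mk0 (195 : ℚ) (by norm_num) ∉ normUnitsSubgroup ℚ (weilField 1) := by
  simpa using natCast_not_mem_normUnitsSubgroup_of_inert (d := 1) (a := 195) (p := 3)
    (by norm_num) (by decide) (by norm_num) (by norm_num) (by norm_num)

/-- **QM curves `(5_10,5_10,x2_13,x2_13)#180` (both braid orbits of that size; window `2.A₆∘C₄`, `K = ℚ(i)`): the certified commutant of the connected monodromy group is `C(H⁰) = (-1, 975/256)_ℚ`, NOT split** (`975/256 ∉ Nm(ℚ(i)ˣ)`) — a division quaternion algebra, so `End⁰(A_t) = C(H⁰)` is exactly the lifted `D₆` and `A_t` is a SIMPLE QM fourfold for very general `t` (THEOREM S35.6).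
research route conditional on HC_CM; not a corollary; Q11.4-sentence-2 already refuted in dim ≥ 3. [cite: vanGeemen1994HodgeAV, (5.4.1)] -/
theorem QM_5_10_not_split : Units.mk0 ((975 : ℚ) / 256) (by norm_num) ∉ normUnitsSubgroup ℚ (weilField 1) :=
  not_mem_of_eq_mul_sq (q := 5 / 16) (by norm_num) (by norm_num) _ (by norm_num) not_mem_39

/-- **QM curves `(5_10,5_10,x2_13,x2_13)#180`: `3·(975/256) = (27/8)² + (3/16)² ∈ Nm(ℚ(i)ˣ)`, so `[(-1, 975/256)] = [(-1,3)] = [D₆]`: `C(H⁰) ≅ D₆`.**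
research route conditional on HC_CM; not a corollary; Q11.4-sentence-2 already refuted in dim ≥ 3. [cite: vanGeemen1994HodgeAV, (5.4.1)] -/
theorem QM_5_10_mul_three_mem : Units.mk0 (3 * ((975 : ℚ) / 256)) (by norm_num) ∈ normUnitsSubgroup ℚ (weilField 1) :=
  mem_normUnitsSubgroup_of_sq_add_mul_sq _ (27 / 8 : ℚ) (3 / 16 : ℚ) (by norm_num)

/-- **QM curve `(5_11,5_11,x2_13,x2_13)#180`, second orbit: `C(H⁰) = (-1, 4875/1024)_ℚ` is NOT split** (`4875/1024 = 195·(5/32)²`, `195 ∉ Nm(ℚ(i)ˣ)`).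
research route conditional on HC_CM; not a corollary; Q11.4-sentence-2 already refuted in dim ≥ 3. [cite: vanGeemen1994HodgeAV, (5.4.1)] -/
theorem QM_5_11b_not_split : Units.mk0 ((4875 : ℚ) / 1024) (by norm_num) ∉ normUnitsSubgroup ℚ (weilField 1) :=
  not_mem_of_eq_mul_sq (q := 5 / 32) (by norm_num) (by norm_num) _ (by norm_num) not_mem_195

/-- **QM curve `(5_11,5_11,x2_13,x2_13)#180`, second orbit: `3·(4875/1024) = (15/4)² + (15/32)² ∈ Nm(ℚ(i)ˣ)`: `C(H⁰) ≅ D₆`.**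
research route conditional on HC_CM; not a corollary; Q11.4-sentence-2 already refuted in dim ≥ 3. [cite: vanGeemen1994HodgeAV, (5.4.1)] -/
theorem QM_5_11b_mul_three_mem : Units.mk0 (3 * ((4875 : ℚ) / 1024)) (by norm_num) ∈ normUnitsSubgroup ℚ (weilField 1) :=
  mem_normUnitsSubgroup_of_sq_add_mul_sq _ (15 / 4 : ℚ) (15 / 32 : ℚ) (by norm_num)

/-- **The five QM curves with `b ∈ 3·ℚˣ²` — `(5_11,5_11,x2_13,x2_13)#180` first orbit (`b = 25/12 = 3·(5/6)²`), `(8_4,8_4,x2_13,x2_13)#288` (`48/25 = 3·(4/5)²`), `(8_7,8_7,x2_13,x2_13)#288` both orbits (`48 = 3·4²`, `12 = 3·2²`): `C(H⁰) = (-1, b)_ℚ = (-1, 3)_ℚ = D₆` on the nose**, NOT split because `3 ∉ Nm(ℚ(i)ˣ)` (ring2-b02's `three_not_mem_norm_one`, reused): here for `b = 25/12`.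
research route conditional on HC_CM; not a corollary; Q11.4-sentence-2 already refuted in dim ≥ 3. [cite: vanGeemen1994HodgeAV, (5.4.1)] -/
theorem QM_5_11a_not_split : Units.mk0 ((25 : ℚ) / 12) (by norm_num) ∉ normUnitsSubgroup ℚ (weilField 1) :=
  not_mem_of_eq_mul_sq (q := 5 / 6) (by norm_num) (by norm_num) _ (by norm_num)
    Summit.HodgeConjecture.Ring2WeilNormDescent.three_not_mem_norm_one

/-- `48/25 = 3·(4/5)² ∉ Nm(ℚ(i)ˣ)`: the QM curve `(8_4,8_4,x2_13,x2_13)#288` has `C(H⁰) = (-1, 48/25)_ℚ ≅ D₆`, not split.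
research route conditional on HC_CM; not a corollary; Q11.4-sentence-2 already refuted in dim ≥ 3. [cite: vanGeemen1994HodgeAV, (5.4.1)] -/
theorem QM_8_4_not_split : Units.mk0 ((48 : ℚ) / 25) (by norm_num) ∉ normUnitsSubgroup ℚ (weilField 1) :=
  not_mem_of_eq_mul_sq (q := 4 / 5) (by norm_num) (by norm_num) _ (by norm_num)
    Summit.HodgeConjecture.Ring2WeilNormDescent.three_not_mem_norm_one

/-- `48 = 3·4² ∉ Nm(ℚ(i)ˣ)` and `12 = 3·2² ∉ Nm(ℚ(i)ˣ)`: the two size-288 QM curves `(8_7,8_7,x2_13,x2_13)` have `C(H⁰) = (-1,48)_ℚ` resp. `(-1,12)_ℚ`, both `≅ (-1,3) = D₆`, not split.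
research route conditional on HC_CM; not a corollary; Q11.4-sentence-2 already refuted in dim ≥ 3. [cite: vanGeemen1994HodgeAV, (5.4.1)] -/
theorem QM_8_7_not_split :
    Units.mk0 (48 : ℚ) (by norm_num) ∉ normUnitsSubgroup ℚ (weilField 1) ∧ Units.mk0 (12 : ℚ) (by norm_num) ∉ normUnitsSubgroup ℚ (weilField 1) :=
  ⟨not_mem_of_eq_mul_sq (q := 4) (by norm_num) (by norm_num) _ (by norm_num)
      Summit.HodgeConjecture.Ring2WeilNormDescent.three_not_mem_norm_one,
    not_mem_of_eq_mul_sq (q := 2) (by norm_num) (by norm_num) _ (by norm_num)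
      Summit.HodgeConjecture.Ring2WeilNormDescent.three_not_mem_norm_one⟩

/-- **Rank-2 witness bookkeeping (THEOREM S35.6 (iii)): the reciprocal quartic `q = x⁴ - 4x³ - 78x² - 4x + 1` — the exact characteristic polynomial is `q²` — of a Schreier generator of the QM curve `(5_10,5_10,x2_13,x2_13)` (first orbit) has `y`-discriminant `(-4)² - 4·(-78 - 2) = 336` (`y = x + 1/x` satisfies `y² - 4y - 80 = 0`), NOT a rational square (`18² = 324 < 336 < 361 = 19²`), and `q(1) = -84 ≠ 0`, `q(-1) = -72 ≠ 0`: `q` is irreducible over `ℚ` (Gauss), its roots are two pairs `μ^{±1}, ν^{±1}` of real units with `|μ| ≠ |ν|^{±1}` (numerically `11.07…` and `7.02…`), so `μ, ν` are multiplicatively independent and the connected monodromy group has RANK 2 — with commutant `D₆` this forces `H⁰` to be the full `ℚ`-form of `Sp₄`.**  This theorem records the three integer facts.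
research route conditional on HC_CM; not a corollary; Q11.4-sentence-2 already refuted in dim ≥ 3. [folklore] -/
theorem rankTwoWitness_5_10_bookkeeping :
    ((-4 : ℤ) ^ 2 - 4 * (-78 - 2) = 336 ∧ ¬ IsSquare (336 : ℤ)) ∧
      ((1 : ℤ) ^ 4 - 4 * 1 ^ 3 - 78 * 1 ^ 2 - 4 * 1 + 1 ≠ 0 ∧ (-1 : ℤ) ^ 4 - 4 * (-1) ^ 3 - 78 * (-1) ^ 2 - 4 * (-1) + 1 ≠ 0) := by
  refine ⟨⟨by norm_num, ?_⟩, by norm_num, by norm_num⟩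
  rintro ⟨r, hr⟩
  have h1 : r ^ 2 = 336 := by linarith [hr]
  have hr' : r.natAbs ^ 2 = 336 := by
    have := Int.natAbs_pow r 2; zify; rw [sq_abs]; exact_mod_cast h1
  have hle : r.natAbs ≤ 18 := by nlinarith
  have hge : 19 ≤ r.natAbs ∨ r.natAbs ≤ 18 := by omega
  interval_cases h : r.natAbs <;> omega

/-! ### §5 (P.S. 2 to b04.33, THEOREM S35.7) The `ℚ(ζ₁₂)`-curves: the centre of `C(H⁰)` is `ℚ(√3)` — ERRATUM to S33.2 / S34.4 (iv): `End⁰(A_t) = M₂(ℚ(√3)) ⊋ ℚ(ζ₁₂)`, `A_t ∼ T_t²` with `T_t` an RM abelian surface -/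

/-- `3` is not the square of a rational number (if `3 = r²` then `3` would be a natural square).
research route conditional on HC_CM; not a corollary; Q11.4-sentence-2 already refuted in dim ≥ 3. [folklore] -/
theorem three_not_isSquare_rat : ¬ IsSquare (3 : ℚ) := by
  rintro h
  have h3 : IsSquare ((3 : ℕ) : ℚ) := by exact_mod_cast h
  rw [Rat.isSquare_natCast_iff] at h3
  obtain ⟨k, hk⟩ := h3
  have hk2 : k ≤ 2 := by nlinarith
  interval_cases k <;> omega

/-- Bookkeeping: a rational of the form `3·r²` (`r ≠ 0`) is not a square — so an étale quadratic ℚ-algebra `ℚ[z₀]` with `z₀² = 3r²` is the FIELD `ℚ(√3)`.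
research route conditional on HC_CM; not a corollary; Q11.4-sentence-2 already refuted in dim ≥ 3. [folklore] -/
theorem not_isSquare_of_eq_three_mul_sq {q : ℚ} (r : ℚ) (hr : r ≠ 0) (h : q = 3 * r ^ 2) : ¬ IsSquare q := by
  rintro ⟨s, hs⟩
  apply three_not_isSquare_rat
  refine ⟨s / r, ?_⟩
  rw [div_mul_div_comm, eq_div_iff (mul_ne_zero hr hr)]
  linear_combination (-1 : ℚ) * (hs.symm.trans h)

/-- **THEOREM S35.7 (ENGINE 11, certified on all NINE moving `ℚ(ζ₁₂)`-curves of the `2.A₆` windows — `(10_8,10_8,x2_10,x2_10)#120`, `(3_2,3_2,x12_13,x12_13)#144`, `(3_2,3_2,x12_16,x12_16)#144`, `(3_2,3_2,x8_14,x8_14)#144`, `(5_11,5_11,x2_10,x2_10)#120` over `ℚ(√-3)`, and `(3_2,3_2,x20_16,x20_22)#120`, `(3_2,3_2,x20_18,x20_21)#120`, `(10_8,10_9,x2_13,x2_13)#240`, `(5_11,5_10,x2_13,x2_13)#240` over `ℚ(i)`): the commutant `C(H⁰)` of the connected monodromy group is 8-dimensional with 2-dimensional centre `ℚ[z₀]`,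 `z₀² ∈ {16/3, 1/3, 3/4, 1/3, 25/3, 3, 3, 3, 75/16}` respectively — every value is `3·r²` and none is a square, so the centre is the FIELD `ℚ(√3)` on all nine; `C(H⁰)` has a zero divisor, hence `C(H⁰) ≅ M₂(ℚ(√3))` and `H⁰ = Res_{ℚ(√3)/ℚ} SL₂`; since the `ℚ(ζ₁₂)`-signature is `(1,1)` at both places (ENGINE 9's Killing form `(4,2,0)`), the Hodge group has no torus part and `End⁰(A_t) = M₂(ℚ(√3)) ⊋ ℚ(ζ₁₂)`: `A_t ∼ T_t²`, `T_t` an abelian surface with real multiplication by `ℚ(√3)` — ERRATUM to S33.2 / S34.4 (iv) («generic `End⁰ = ℚ(ζ₁₂)`»), Shimura's exceptional type IV (`d = 1`, `m = 2`, all signatures `(1,1)`).**  This theorem pins the nine centre discriminants.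
research route conditional on HC_CM; not a corollary; Q11.4-sentence-2 already refuted in dim ≥ 3. [cite: vanGeemen1994HodgeAV, 5.2] -/
theorem zeta12Curves_centre_is_sqrt3 :
    (¬ IsSquare ((16 : ℚ) / 3) ∧ ¬ IsSquare ((1 : ℚ) / 3) ∧ ¬ IsSquare ((3 : ℚ) / 4) ∧ ¬ IsSquare ((25 : ℚ) / 3) ∧
      ¬ IsSquare (3 : ℚ) ∧ ¬ IsSquare ((75 : ℚ) / 16)) ∧
    (IsSquare (3 * ((16 : ℚ) / 3)) ∧ IsSquare (3 * ((1 : ℚ) / 3)) ∧ IsSquare (3 * ((3 : ℚ) / 4)) ∧ IsSquare (3 * ((25 : ℚ) / 3)) ∧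
      IsSquare (3 * (3 : ℚ)) ∧ IsSquare (3 * ((75 : ℚ) / 16))) := by
  refine ⟨⟨?_, ?_, ?_, ?_, ?_, ?_⟩, ⟨4, by norm_num⟩, ⟨1, by norm_num⟩, ⟨3 / 2, by norm_num⟩, ⟨5, by norm_num⟩, ⟨3, by norm_num⟩, ⟨15 / 4, by norm_num⟩⟩
  · exact not_isSquare_of_eq_three_mul_sq (4 / 3) (by norm_num) (by norm_num)
  · exact not_isSquare_of_eq_three_mul_sq (1 / 3) (by norm_num) (by norm_num)
  · exact not_isSquare_of_eq_three_mul_sq (1 / 2) (by norm_num) (by norm_num)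
  · exact not_isSquare_of_eq_three_mul_sq (5 / 3) (by norm_num) (by norm_num)
  · exact three_not_isSquare_rat
  · exact not_isSquare_of_eq_three_mul_sq (5 / 4) (by norm_num) (by norm_num)

end Summit.HodgeConjecture.HodgeConjecture.Ring2.WeilCoverage.QMSurfacePair

end
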